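import Summits.NavierStokesRegularity.NavierStokesRegularity.Theorems.TypeICertificateLadderTargetRssCompactnessLimit
import HarnessLib

/-!
# Compactness of Type I RSS solutions at a general rotation speed: extraction with the profiles

Summit `NavierStokesRegularity`, crux `TypeICertificateLadder.NoTypeIBlowup`, line
`killing-twisted-bernoulli-solitons`. The sibling extraction step `rssCompact_exists_limit` — the
Chae–Wolf 2017, §3 compactness argument for rotated self-similar (RSS, Pineau–Vicol 2026, (1.7))
Type I classical Navier–Stokes solutions, run with rotation speeds `α_n → α₀` (an arbitrary limit
speed) and Type I constants `C_n → C⋆`, `C_n ≤ C₀` — with one more conclusion recorded: the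
extracted subsequence `φ` itself together with the pointwise convergence of the PROFILES,
`U_{φ(n)}(y) → v(−1, y)` for every `y ∈ ℝ³` (the ansatz fields at time `−1` are the profiles,
`w_n(−1, ·) = U_n`, Pineau–Vicol 2026, Remark 1.3, and the extracted subsequence converges
pointwise on `(−∞, −1/4] × ℝ³`). As there, the limit `v` is a continuous Type I (constant `C⋆`)
bounded weak solution which is RSS-symmetric with speed `α₀` —
`v(t,x) = μ R(2α₀ log μ) v(μ²t, μ R(−2α₀ log μ) x)` for every `μ ≥ 1` — and nontrivial at time
`−1`. The profile convergence feeds the compactness proofs of quantitative symmetry-defect bounds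
on the Type I RSS strata.

## References

* D. Chae, J. Wolf, *Removing discretely self-similar singularities for the 3D Navier–Stokes
  equations*, Comm. PDE 42 (2017) 1359–1374 = arXiv:1610.09464, §3 (Step 2).
* B. Pineau, V. Vicol, *On rotated backwards self-similar solutions of the incompressible 3D
  Navier–Stokes equations*, arXiv:2607.09619 (2026), §1.2 (definition of RSS), Remarks 1.2–1.3.
-/

set_option linter.dupNamespace false

noncomputable section

open Set Function Filter MeasureTheory Metric
open scoped Topology NNReal

namespace Summit.NavierStokesRegularity.NavierStokesRegularity.Theorems

open Literature.Analysis.FluidPDE Literature.Analysis.FluidPDE.PineauVicol2026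

/-! ### The extraction at a general limit speed `α₀`, with the profiles -/

/-- **The compactness step with the profiles (Chae–Wolf 2017, §3, Step 2, run with `α_n → α₀`,
`C_n → C⋆`; Pineau–Vicol 2026, Remark 1.3).**
Let `w_n` be the RSS ansatz fields (1.7) with speeds `α_n → α₀` and time-independent profiles
`U_n ≠ 0`, each a classical Navier–Stokes solution (`ν = 1`, `f = 0`) on `ℝ³ × (−∞, 0)` obeying
the Type I bound `‖w_n(t,x)‖ ≤ C_n/(‖x‖ + √(−t))` with `0 ≤ C_n ≤ C₀`, `C_n → C⋆`. Then along a
subsequence `φ` the fields converge, locally uniformly on `(−∞, −1/4] × ℝ³` (uniform Lipschitz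
bounds `ChaeWolf.exists_uniform_lipschitz` for the common constant `C₀` and the pointwise
Arzelà–Ascoli theorem `exists_strictMono_tendsto_of_lipschitzWith`), to a continuous field `v` with
the Type I bound of constant `C⋆`, which is a bounded weak Navier–Stokes solution on `(−∞, −1/4)`
(written for `t ↦ v(t − 1/4)` on `(−∞, 0)`), is **rotated self-similar with speed `α₀`** —
`v(t,x) = μ R(θ₀) v(μ²t, μ R(−θ₀) x)`, `θ₀ = 2α₀ log μ`, for every `μ ≥ 1`, because
`w_n(t,x) = μ R(θ_n) w_n(μ²t, μR(−θ_n)x)` with `θ_n = 2α_n log μ → θ₀`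
(`pvAnsatz_rss_eq_smul_rotZ`, equicontinuity, `rssCompact_tendsto_rotZ_of_tendsto`) —
**nontrivial at time `−1`** (smallness lemma `ChaeWolf.exists_eps_typeI_small_eq_zero`, the size
identity `√(−t)|w_n(t,x)| = |U_n(y)|`, the profile bound (1.9) and `w_n(−1, ·) = U_n`), and the
**profiles converge pointwise along `φ`**: `U_{φ(n)}(y) → v(−1, y)` for every `y`, since
`w_n(−1, ·) = U_n` (`pvAnsatz_neg_one`). -/
theorem rssCompact_exists_limit_profile :
    ∀ (C₀ Cstar α₀ : ℝ) (C α : ℕ → ℝ)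
      (U : ℕ → EuclideanSpace ℝ (Fin 3) → EuclideanSpace ℝ (Fin 3))
      (P : ℕ → ℝ → EuclideanSpace ℝ (Fin 3) → ℝ),
      0 < C₀ → (∀ n, 0 ≤ C n) → (∀ n, C n ≤ C₀) → Tendsto C atTop (𝓝 Cstar) →
      Tendsto α atTop (𝓝 α₀) →
      (∀ n, Literature.Analysis.FluidPDE.IsClassicalNSSolutionOn (Iio 0) 1 0
        (Literature.Analysis.FluidPDE.pvAnsatz (α n) (fun y _ => U n y)) (P n)) →
      (∀ n, Literature.Analysis.FluidPDE.HasTypeIDecay (C n)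
        (Literature.Analysis.FluidPDE.pvAnsatz (α n) (fun y _ => U n y))) →
      (∀ n, U n ≠ 0) →
      ∃ v : ℝ → EuclideanSpace ℝ (Fin 3) → EuclideanSpace ℝ (Fin 3), Continuous (uncurry v) ∧
        (∀ t ≤ -(1 / 4 : ℝ), ∀ x, ‖v t x‖ ≤ Cstar / (‖x‖ + √(-t))) ∧
        Literature.Analysis.FluidPDE.IsBoundedWeakNSSolutionOn (Iio 0) isOpen_Iio 1
          (fun t => v (t - 1 / 4)) ∧
        (∀ μ : ℝ, 1 ≤ μ → ∀ t ≤ -(1 / 4 : ℝ), ∀ x,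
          v t x = μ • Literature.Analysis.FluidPDE.rotZ (α₀ * (2 * Real.log μ))
            (v (μ ^ 2 * t)
              (μ • Literature.Analysis.FluidPDE.rotZ (-(α₀ * (2 * Real.log μ))) x))) ∧
        (∃ x : EuclideanSpace ℝ (Fin 3), v (-1) x ≠ 0) ∧
        ∃ φ : ℕ → ℕ, StrictMono φ ∧ ∀ y : EuclideanSpace ℝ (Fin 3),
          Filter.Tendsto (fun n => U (φ n) y) Filter.atTop (nhds (v (-1) y)) := by
  -- adapted from Summits/.../Theorems/TypeICertificateLadderTargetRssCompactnessLimit.lean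
  -- (rssCompact_exists_limit), itself from Literature/Analysis/FluidPDE/PineauVicolRSSHolds.lean
  intro C₀ Cstar α₀ C α U P hC₀ _hC0 hCle hC hα hcl hI hnt
  -- the RSS fields
  set w : ℕ → ℝ → EuclideanSpace ℝ (Fin 3) → EuclideanSpace ℝ (Fin 3) :=
    fun n => pvAnsatz (α n) (fun y _ => U n y) with hw
  -- the Type I bounds with the common constant `C₀`
  have hI' : ∀ n, HasTypeIDecay C₀ (w n) := fun n t ht x =>
    (hI n t ht x).trans (div_le_div_of_nonneg_right (hCle n) (by positivity))
  obtain ⟨K, L, hK, hL, hKL⟩ := ChaeWolf.exists_uniform_lipschitz hC₀.le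
  obtain ⟨ε₀, hε₀, hA⟩ := ChaeWolf.exists_eps_typeI_small_eq_zero
  -- the profile bound (1.9) from the Type I bound at `t = -1` (Remark 1.2)
  have hUb : ∀ n (y : EuclideanSpace ℝ (Fin 3)), ‖U n y‖ ≤ C₀ / (‖y‖ + 1) := fun n =>
    profile_bound_of_typeI (α := α n) (u := w n) (fun t ht x => hI' n t ht.2 x) fun _ _ _ => rfl
  -- Step 1 (nontriviality survives at the fixed time `-1`)
  have hwit : ∀ n, ∃ y : EuclideanSpace ℝ (Fin 3),
      ‖y‖ ≤ C₀ / ε₀ ∧ ε₀ ≤ ‖w n (-1) y‖ := by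
    intro n
    -- a point with a large scale-invariant size, by the smallness lemma
    obtain ⟨t', ht', x', hq'⟩ : ∃ t' < 0, ∃ x', ε₀ < √(-t') * ‖w n t' x'‖ := by
      by_contra hcon
      push Not at hcon
      have hzero := hA hC₀.le (hcl n) (hI' n) hcon (-1) (by norm_num)
      refine hnt n (funext fun y => ?_)
      simpa [pvAnsatz_neg_one] using hzero y
    -- in terms of the profile: `√(-t') ‖w n t' x'‖ = ‖U n y'‖`
    have hs : 0 < √(-t') := Real.sqrt_pos.2 (by linarith)
    set y' : EuclideanSpace ℝ (Fin 3) :=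
      rotZ (-(α n * -Real.log (-t'))) ((√(-t'))⁻¹ • x') with hy'
    have hUy : ε₀ < ‖U n y'‖ := by
      have e : √(-t') * ‖w n t' x'‖ = ‖U n y'‖ := by
        rw [show w n t' x' = pvAnsatz (α n) (fun y _ => U n y) t' x' from rfl, norm_pvAnsatz,
          ← mul_assoc, mul_inv_cancel₀ hs.ne', one_mul]
      rwa [e] at hq'
    refine ⟨y', ?_, ?_⟩
    · have h1 : ε₀ < C₀ / (‖y'‖ + 1) := hUy.trans_le (hUb n y')
      rw [lt_div_iff₀ (by positivity)] at h1
      rw [le_div_iff₀ hε₀]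
      nlinarith [norm_nonneg y', hε₀]
    · rw [show w n (-1) y' = U n y' from pvAnsatz_neg_one _ _ _]
      exact hUy.le
  -- the equi-Lipschitz family on `ℝ × ℝ³` (fields frozen at time `-1/4` for later times)
  set Kx : ℝ≥0 := (K + L).toNNReal with hKx
  have hKx' : (Kx : ℝ) = K + L := by rw [hKx, Real.coe_toNNReal _ (by positivity)]
  set f : ℕ → ℝ × EuclideanSpace ℝ (Fin 3) → EuclideanSpace ℝ (Fin 3) :=
    fun n q => w n (min q.1 (-(1 / 4 : ℝ))) q.2 with hf
  have hf_of_le : ∀ n {t : ℝ} (_ : t ≤ -(1 / 4 : ℝ)) (x : EuclideanSpace ℝ (Fin 3)),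
      f n (t, x) = w n t x :=
    fun n t ht x => by simp only [hf, min_eq_left ht]
  have hlip : ∀ n, LipschitzWith Kx (f n) := by
    intro n
    obtain ⟨hsp, htm⟩ := hKL (hcl n) (hI' n)
    refine LipschitzWith.of_dist_le_mul fun q q' => ?_
    rw [hKx', dist_eq_norm, Prod.dist_eq, Real.dist_eq, dist_eq_norm]
    have hm : min q.1 (-(1 / 4 : ℝ)) ≤ -(1 / 4 : ℝ) := min_le_right _ _
    have hm' : min q'.1 (-(1 / 4 : ℝ)) ≤ -(1 / 4 : ℝ) := min_le_right _ _
    have hmin : |min q.1 (-(1 / 4 : ℝ)) - min q'.1 (-(1 / 4 : ℝ))| ≤ |q.1 - q'.1| := by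
      refine (abs_min_sub_min_le_max _ _ _ _).trans (max_le le_rfl ?_)
      rw [sub_self, abs_zero]; exact abs_nonneg _
    calc ‖w n (min q.1 (-(1 / 4))) q.2 - w n (min q'.1 (-(1 / 4))) q'.2‖
        ≤ ‖w n (min q.1 (-(1 / 4))) q.2 - w n (min q.1 (-(1 / 4))) q'.2‖ +
            ‖w n (min q.1 (-(1 / 4))) q'.2 - w n (min q'.1 (-(1 / 4))) q'.2‖ :=
          norm_sub_le_norm_sub_add_norm_sub _ _ _
      _ ≤ K * ‖q.2 - q'.2‖ + L * |min q.1 (-(1 / 4 : ℝ)) - min q'.1 (-(1 / 4 : ℝ))| :=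
          add_le_add (hsp _ hm _ _) (htm _ hm' _ hm _)
      _ ≤ K * max |q.1 - q'.1| ‖q.2 - q'.2‖ + L * max |q.1 - q'.1| ‖q.2 - q'.2‖ := by
          gcongr
          · exact le_max_right _ _
          · exact hmin.trans (le_max_left _ _)
      _ = (K + L) * max |q.1 - q'.1| ‖q.2 - q'.2‖ := by ring
  have hball : ∀ n q, f n q ∈ closedBall (0 : EuclideanSpace ℝ (Fin 3)) (2 * C₀) :=
      fun n q => by
    rw [mem_closedBall, dist_zero_right]
    exact ChaeWolf.typeI_norm_le_two_mul hC₀.le (hI' n) (min_le_right _ _) _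
  obtain ⟨φ, l, hφ, hl, -, hlim⟩ := exists_strictMono_tendsto_of_lipschitzWith f hlip hball
  -- the limit field
  set v : ℝ → EuclideanSpace ℝ (Fin 3) → EuclideanSpace ℝ (Fin 3) := fun t x => l (t, x) with hv
  have hlimv : ∀ {t : ℝ} (_ : t ≤ -(1 / 4 : ℝ)) (x : EuclideanSpace ℝ (Fin 3)),
      Tendsto (fun n => w (φ n) t x) atTop (𝓝 (v t x)) := by
    intro t ht x
    simpa only [hf_of_le _ ht] using hlim (t, x)
  have hvc : Continuous (uncurry v) := by
    have e : uncurry v = l := by funext q; rfl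
    rw [e]; exact hl.continuous
  have h14 : (-1 : ℝ) ≤ -(1 / 4 : ℝ) := by norm_num
  refine ⟨v, hvc, ?_, ?_, ?_, ?_, φ, hφ, fun y => ?_⟩
  · -- the Type I bounds `C (φ n) → C⋆` pass to the limit
    intro t ht x
    exact le_of_tendsto_of_tendsto' (hlimv ht x).norm ((hC.comp hφ.tendsto_atTop).div_const _)
      fun n => hI (φ n) t (by linarith) x
  · -- bounded weak solution on `(-∞, -1/4)`, shifted to `(-∞, 0)`
    have hA' : Tendsto (fun k : ℕ => -(k : ℝ) + -1) atTop atBot :=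
      (tendsto_neg_atTop_atBot.comp tendsto_natCast_atTop_atTop).atBot_add tendsto_const_nhds
    have e14 : ∀ t : ℝ, t - 1 / 4 = t + -(1 / 4 : ℝ) := fun t => by ring
    have hV : ∀ k : ℕ, IsBoundedWeakNSSolutionOn (Ioo (-(k : ℝ) + -1) 0) isOpen_Ioo 1
        (fun t => w (φ k) (t - 1 / 4)) := by
      intro k
      have hcl' : IsClassicalNSSolutionOn (Ioo (-(k : ℝ) + -1 + -(1 / 4)) (-(1 / 4))) 1 0
          (w (φ k)) (P (φ k)) :=
        (hcl (φ k)).mono (fun t ht => by simp only [mem_Iio]; linarith [ht.2])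
          (uniqueDiffOn_Ioo _ _)
      have hbdd : IsBoundedOn (Ioo (-(k : ℝ) + -1 + -(1 / 4)) (-(1 / 4))) (w (φ k)) :=
        ⟨2 * C₀, fun t ht x => ChaeWolf.typeI_norm_le_two_mul hC₀.le (hI' (φ k)) ht.2.le x⟩
      have h := (hcl'.isBoundedWeakNSSolutionOn hbdd).comp_add_right (-(1 / 4 : ℝ))
        (J := Ioo (-(k : ℝ) + -1) 0) isOpen_Ioo fun t => by
          simp only [mem_Ioo]
          constructor <;> intro h <;> constructor <;> linarith [h.1, h.2]
      simpa only [e14] using h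
    have hcont : ∀ k : ℕ, ContinuousOn (uncurry fun t => w (φ k) (t - 1 / 4))
        (Ioo (-(k : ℝ) + -1) 0 ×ˢ univ) := by
      intro k
      have h1 := ((hcl (φ k)).smooth_velocity.comp_add_right (-(1 / 4 : ℝ))).continuousOn
      refine (h1.mono (prod_mono (fun t ht => ?_) Subset.rfl)).congr fun q _ => by
        simp only [uncurry, e14, hw]
      simp only [mem_preimage, mem_Iio]
      linarith [ht.2]
    have hbd : ∀ k : ℕ, ∀ t ∈ Ioo (-(k : ℝ) + -1) 0, ∀ x,
        ‖w (φ k) (t - 1 / 4) x‖ ≤ 2 * C₀ :=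
      fun k t ht x => ChaeWolf.typeI_norm_le_two_mul hC₀.le (hI' (φ k)) (by linarith [ht.2]) x
    have hvc' : Continuous (uncurry fun t x => v (t - 1 / 4) x) :=
      hvc.comp ((continuous_fst.sub continuous_const).prodMk continuous_snd)
    exact isBoundedWeakNSSolutionOn_of_tendsto hA' hV hcont hbd hvc'
      fun t ht x => hlimv (by linarith) x
  · -- rotated self-similarity of the limit: the angles `2 α_n log μ` tend to `2 α₀ log μ`
    intro μ hμ t ht x
    have hμ0 : 0 < μ := one_pos.trans_le hμ
    have ht0 : t ≤ 0 := by linarith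
    set θ₀ : ℝ := α₀ * (2 * Real.log μ) with hθ₀
    set θ : ℕ → ℝ := fun n => α n * (2 * Real.log μ) with hθ
    have hθlim : Tendsto (fun n => θ (φ n)) atTop (𝓝 θ₀) :=
      (hα.comp hφ.tendsto_atTop).mul_const _
    -- the twisted scaling identity along the sequence
    have hid : ∀ n, w n t x = μ • rotZ (θ n) (w n (μ ^ 2 * t) (μ • rotZ (-(θ n)) x)) :=
      fun n => pvAnsatz_rss_eq_smul_rotZ (α n) (U n) hμ0 t x
    -- the moving points stay in `t ≤ -1/4`
    have hmem : μ ^ 2 * t ≤ -(1 / 4 : ℝ) :=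
      (mul_le_of_one_le_left ht0 (one_le_pow₀ hμ)).trans ht
    have hrot : Tendsto (fun n => rotZ (-(θ (φ n))) x) atTop (𝓝 (rotZ (-θ₀) x)) :=
      rssCompact_tendsto_rotZ_of_tendsto hθlim.neg tendsto_const_nhds
    set q : ℕ → ℝ × EuclideanSpace ℝ (Fin 3) :=
      fun n => (μ ^ 2 * t, μ • rotZ (-(θ (φ n))) x) with hq
    have hqlim : Tendsto q atTop (𝓝 (μ ^ 2 * t, μ • rotZ (-θ₀) x)) :=
      tendsto_const_nhds.prodMk_nhds (hrot.const_smul μ)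
    have h1 : Tendsto (fun n => f (φ n) (q n)) atTop
        (𝓝 (v (μ ^ 2 * t) (μ • rotZ (-θ₀) x))) :=
      ChaeWolf.tendsto_apply_of_tendsto (fun n => hlip (φ n)) hqlim
        (hlim (μ ^ 2 * t, μ • rotZ (-θ₀) x))
    have h1' : Tendsto (fun n => w (φ n) (μ ^ 2 * t) (μ • rotZ (-(θ (φ n))) x)) atTop
        (𝓝 (v (μ ^ 2 * t) (μ • rotZ (-θ₀) x))) := by
      refine h1.congr fun n => ?_
      simp only [hq, hf_of_le _ hmem]
    have h2 : Tendsto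
        (fun n => rotZ (θ (φ n)) (w (φ n) (μ ^ 2 * t) (μ • rotZ (-(θ (φ n))) x))) atTop
        (𝓝 (rotZ θ₀ (v (μ ^ 2 * t) (μ • rotZ (-θ₀) x)))) :=
      rssCompact_tendsto_rotZ_of_tendsto hθlim h1'
    have h3 : Tendsto (fun n => w (φ n) t x) atTop
        (𝓝 (μ • rotZ θ₀ (v (μ ^ 2 * t) (μ • rotZ (-θ₀) x)))) := by
      refine (h2.const_smul μ).congr fun n => ?_
      exact (hid (φ n)).symm
    exact tendsto_nhds_unique (hlimv ht x) h3
  · -- nontriviality at time `-1`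
    choose y hyb hyw using hwit
    have hSc : IsCompact (closedBall (0 : EuclideanSpace ℝ (Fin 3)) (C₀ / ε₀)) :=
      isCompact_closedBall _ _
    have hmemS : ∀ n, y (φ n) ∈ closedBall (0 : EuclideanSpace ℝ (Fin 3)) (C₀ / ε₀) :=
        fun n => by
      rw [mem_closedBall, dist_zero_right]; exact hyb (φ n)
    obtain ⟨ybar, -, ψ, hψ, hconv⟩ := hSc.tendsto_subseq hmemS
    refine ⟨ybar, fun h0 => ?_⟩
    have hy0 : Tendsto (fun n => f (φ (ψ n)) ((-1 : ℝ), ybar)) atTop (𝓝 (v (-1) ybar)) :=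
      (hlim ((-1 : ℝ), ybar)).comp hψ.tendsto_atTop
    have hconv' : Tendsto (fun n => ((-1 : ℝ), y (φ (ψ n)))) atTop (𝓝 ((-1 : ℝ), ybar)) :=
      tendsto_const_nhds.prodMk_nhds hconv
    have hmain := ChaeWolf.tendsto_apply_of_tendsto (fun n => hlip (φ (ψ n))) hconv' hy0
    have hge : ε₀ ≤ ‖v (-1) ybar‖ := by
      refine ge_of_tendsto' hmain.norm fun n => ?_
      simp only [hf_of_le _ h14]
      exact hyw (φ (ψ n))
    rw [h0, norm_zero] at hge
    linarith
  · -- the profiles converge along the subsequence: `w n (-1) = U n` (Remark 1.3)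
    refine (hlimv h14 y).congr fun n => ?_
    exact pvAnsatz_neg_one _ _ _

end Summit.NavierStokesRegularity.NavierStokesRegularity.Theorems

end
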